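import Literature.NumberTheory.EllipticCurves.SerreOpenImageSupersingularInertiaProofs
import Literature.NumberTheory.EllipticCurves.SerreOpenImageReductionInertiaProofs
import Literature.NumberTheory.EllipticCurves.SerreOpenImageTameKummerProofs
import Literature.NumberTheory.EllipticCurves.SerreOpenImageOrdinaryInertiaProofs
import Literature.NumberTheory.EllipticCurves.AnticyclotomicInertiaAboveP
import Literature.NumberTheory.EllipticCurves.TateModuleGaloisTransportProofs
import Literature.NumberTheory.EllipticCurves.ZpExtensionUnramifiedProofs
import Literature.NumberTheory.EllipticCurves.GreenbergSelmer
import Literature.NumberTheory.GaloisRepresentations.AbsIntegersEquiv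
import Literature.NumberTheory.GaloisRepresentations.SorensenPatching
import Literature.NumberTheory.GaloisRepresentations.IntegralGaloisActionProofs
import Literature.NumberTheory.GaloisRepresentations.DecompositionGroupOfCompletion
import HarnessLib

/-!
# Serre 1972, §1.11 Prop. 12 (c) over an imaginary quadratic field at a split supersingular prime:
# the inertia group `I_v̄ ≤ Γ_K` acts on `E[p]` through a cyclic group of order `p² − 1`

`Proofs` file (theorems only). The tree proves Serre's Prop. 12 (c) for `E/ℚ` at a good SUPERSINGULAR
odd prime `p` and the prime `𝔓₀` of `\bar ℤ` cut out by the place (`isCyclic_and_card_inertia_map_of_dvd_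
frobeniusTrace`: `ρ̄_{E,p}(I_{𝔓₀})` is cyclic of order `p² − 1`). This file TRANSPORTS it to the base
change `E_K` over an imaginary quadratic field `K` in which `p = v v̄` splits, at the tree's inertia group
`I_v̄ = GreenbergSelmer.inertia v̄ ≤ Γ_K` — the hypothesis (S) of the BSD cell's reduction of
`stub_torsionSS` (crux `AnticyclotomicEisensteinDivisibility`; Summits
`…AcDivControlTorsion.stub_torsionSS_of_isTorsion_XAc_of_serre_of_away`; Literature
`InertiaFixedPoint.primary_eq_zero_of_forall_pairKer_inf_inertia_smul_eq`). Serre's statement is local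
("Soit `v` une place … `e = 1`"): for `K_v̄ = ℚ_p` it is the same statement, and the proof below is the
corresponding bookkeeping:

* §1 `nonempty_mulEquiv_map_of_forall_eq_one_iff` — two homomorphisms with the same kernel on a
  subgroup `H` have isomorphic images of `H` (first isomorphism theorem).
* §2 `galoisRepTorsion_absGaloisRestrict_eq_one_iff` — along the equivariant identification
  `E(ℚ̄) ≃ E_K(K̄)` (`exists_addEquiv_geomPoints_baseChange`), `ρ̄_{E}(res γ) = 1 ↔ ρ̄_{E_K}(γ) = 1`; hence
  `ρ̄_{E_K}(H) ≅ ρ̄_E(res H)` for every `H ≤ Γ_K` (`nonempty_mulEquiv_map_galoisRepTorsion_baseChange`).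
* §3 `map_inertia_smul_eq` — `ρ̄(I_{g𝔓}) = ρ̄(g) ρ̄(I_𝔓) ρ̄(g)⁻¹`; images of conjugate primes are
  isomorphic.
* §4 `res(I_v̄) = I_𝔔` for the contraction `𝔔 = 𝔓_{v̄} ∩ \bar ℤ_ℚ` when `p` splits completely
  (`comap_inertia_comap_absIntegersMap`, `D_𝔔 ≤ res Γ_K`:
  `SorensenPatching.decompositionSubgroup_le_range_of_ncard_primesOver_eq`), and the assembly
  **`isCyclic_and_card_inertia_map_baseChange`**: for `E/ℚ` globally minimal with good supersingular
  reduction at the odd prime `p`, `K` imaginary quadratic with `p = v v̄` split: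
  `IsCyclic (ρ̄_{E_K,p}(I_v̄)) ∧ #ρ̄_{E_K,p}(I_v̄) = p² − 1`.

References: J.-P. Serre, Invent. Math. 15 (1972), §1.11 Prop. 12; J. Neukirch, *Algebraic Number
Theory*, Ch. I §9 (9.1)–(9.6), Ch. II §9 (9.6).
-/

noncomputable section

open scoped Classical Pointwise

open Field NumberField IsDedekindDomain WeierstrassCurve Rat.HeightOneSpectrum
open Literature.NumberTheory.GaloisRepresentations

universe u

namespace Literature.NumberTheory.EllipticCurves.InertiaFixedPoint

/-! ## §1 Images under homomorphisms with the same kernel on a subgroup -/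

/-- Two homomorphisms that kill the same elements of a subgroup `H` have isomorphic images of `H`
(first isomorphism theorem on `H`). [folklore] -/
private theorem nonempty_mulEquiv_map_of_forall_eq_one_iff {G A B : Type*} [Group G] [Group A] [Group B]
    (f₁ : G →* A) (f₂ : G →* B) (H : Subgroup G) (h : ∀ g ∈ H, f₁ g = 1 ↔ f₂ g = 1) :
    Nonempty (H.map f₁ ≃* H.map f₂) := by
  have hker : (f₁.restrict H).ker = (f₂.restrict H).ker := by
    ext g
    rw [MonoidHom.mem_ker, MonoidHom.mem_ker, MonoidHom.restrict_apply, MonoidHom.restrict_apply]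
    exact h g g.2
  have e₁ := QuotientGroup.quotientKerEquivRange (f₁.restrict H)
  have e₂ := QuotientGroup.quotientKerEquivRange (f₂.restrict H)
  have e := (e₁.symm.trans (QuotientGroup.quotientMulEquivOfEq hker)).trans e₂
  exact ⟨((MulEquiv.subgroupCongr (MonoidHom.restrict_range H f₁)).symm.trans e).trans
    (MulEquiv.subgroupCongr (MonoidHom.restrict_range H f₂))⟩

/-- Isomorphic subgroups: cyclicity and cardinality transfer. [folklore] -/
private theorem isCyclic_and_card_of_mulEquiv {A B : Type*} [Group A] [Group B] {H₁ : Subgroup A}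
    {H₂ : Subgroup B} (e : H₁ ≃* H₂) {n : ℕ} (h : IsCyclic H₁ ∧ Nat.card H₁ = n) :
    IsCyclic H₂ ∧ Nat.card H₂ = n := by
  haveI := h.1
  exact ⟨isCyclic_of_surjective e.toMonoidHom e.surjective, by rw [← h.2, Nat.card_congr e.toEquiv.symm]⟩

/-! ## §2 Base change: `ρ̄_{E_L}(γ)` and `ρ̄_E(res γ)` -/

section BaseChange

variable {F : Type u} [Field F] (W : WeierstrassCurve F) (L : Type u) [Field L] [Algebra F L]
  [Algebra.IsAlgebraic F L]

/-- **`ρ̄_{E}(res γ) = 1 ↔ ρ̄_{E_L}(γ) = 1`** for `γ ∈ Γ_L`, `L/F` algebraic: the equivariant identification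
`e : E(F̄) ≃ E_L(L̄)`, `e(res γ • P) = γ • e P` (`exists_addEquiv_geomPoints_baseChange`) matches
`n`-torsion with `n`-torsion. [cite: SilvermanAEC2009, VIII.§1 (Galois action on `E[m]` under base change)] -/
theorem galoisRepTorsion_absGaloisRestrict_eq_one_iff (n : ℤ) (γ : absoluteGaloisGroup L) :
    galoisRepTorsion W n (absGaloisRestrict F L γ) = 1 ↔ galoisRepTorsion (W.baseChange L) n γ = 1 := by
  obtain ⟨e, he⟩ := W.exists_addEquiv_geomPoints_baseChange L
  rw [galoisRepTorsion_eq_one_iff', galoisRepTorsion_eq_one_iff']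
  constructor
  · intro h P'
    have hQ : e.symm (P' : geomPoints (W.baseChange L)) ∈ geomTorsion W n := by
      refine (Submodule.mem_torsionBy_iff _ _).mpr ?_
      change n • e.symm (P' : geomPoints (W.baseChange L)) = 0
      rw [← map_zsmul, show n • (P' : geomPoints (W.baseChange L)) = 0 from
        (Submodule.mem_torsionBy_iff _ _).mp P'.2, map_zero]
    have h1 := congrArg (fun Q : geomTorsion W n ↦ e (Q : geomPoints W)) (h ⟨_, hQ⟩)
    simp only [AddSubgroup.torsionBy.coe_smul, he, AddEquiv.apply_symm_apply] at h1
    exact Subtype.ext h1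
  · intro h P
    have hQ : e (P : geomPoints W) ∈ geomTorsion (W.baseChange L) n := by
      refine (Submodule.mem_torsionBy_iff _ _).mpr ?_
      change n • e (P : geomPoints W) = 0
      rw [← map_zsmul, show n • (P : geomPoints W) = 0 from
        (Submodule.mem_torsionBy_iff _ _).mp P.2, map_zero]
    have h1 := congrArg (fun Q : geomTorsion (W.baseChange L) n ↦ (Q : geomPoints (W.baseChange L)))
      (h ⟨_, hQ⟩)
    simp only [AddSubgroup.torsionBy.coe_smul, ← he] at h1
    exact Subtype.ext (e.injective h1)

/-- **`ρ̄_{E_L,n}(H) ≅ ρ̄_{E,n}(res H)`** for every subgroup `H ≤ Γ_L` (`L/F` algebraic).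
[cite: SilvermanAEC2009, VIII.§1] -/
theorem nonempty_mulEquiv_map_galoisRepTorsion_baseChange (n : ℤ) (H : Subgroup (absoluteGaloisGroup L)) :
    Nonempty (H.map (galoisRepTorsion (W.baseChange L) n) ≃*
      (H.map (absGaloisRestrict F L).toMonoidHom).map (galoisRepTorsion W n)) := by
  rw [Subgroup.map_map]
  exact nonempty_mulEquiv_map_of_forall_eq_one_iff _ _ H fun g _ ↦
    (galoisRepTorsion_absGaloisRestrict_eq_one_iff W L n g).symm

end BaseChange

/-! ## §3 Conjugate primes -/

section Conj

variable {K : Type u} [Field K] [NumberField K] {G : Type*} [Group G]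

omit [NumberField K] in
/-- `ρ̄(I_{g𝔓}) = ρ̄(g) ρ̄(I_𝔓) ρ̄(g)⁻¹` (`I_{g𝔓} = g I_𝔓 g⁻¹`). [cite: NeukirchANT1999, Ch. I §9 (9.4)] -/
theorem map_inertia_smul_eq (f : absoluteGaloisGroup K →* G) (g : absoluteGaloisGroup K)
    (𝔓 : Ideal (absIntegers (𝓞 K) K)) :
    ((g • 𝔓).inertia (absoluteGaloisGroup K)).map f =
      ((𝔓.inertia (absoluteGaloisGroup K)).map f).map (MulAut.conj (f g)).toMonoidHom := by
  rw [Subgroup.map_map]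
  ext x
  constructor
  · rintro ⟨σ, hσ, rfl⟩
    have h := (HeightOneSpectrum.mem_inertia_smul_absIntegers_iff g σ 𝔓).mp hσ
    refine ⟨g⁻¹ * σ * g, h, ?_⟩
    simp only [MonoidHom.coe_comp, MulEquiv.coe_toMonoidHom, Function.comp_apply, MulAut.conj_apply,
      map_mul, map_inv]
    group
  · rintro ⟨τ, hτ, rfl⟩
    have hτ' : τ ∈ 𝔓.inertia (absoluteGaloisGroup K) := hτ
    have hmem : g * τ * g⁻¹ ∈ (g • 𝔓).inertia (absoluteGaloisGroup K) := by
      refine (HeightOneSpectrum.mem_inertia_smul_absIntegers_iff g _ 𝔓).mpr ?_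
      have e1 : g⁻¹ * (g * τ * g⁻¹) * g = τ := by group
      rw [e1]
      exact hτ'
    refine ⟨g * τ * g⁻¹, hmem, ?_⟩
    simp only [MonoidHom.coe_comp, MulEquiv.coe_toMonoidHom, Function.comp_apply, MulAut.conj_apply,
      map_mul, map_inv]

omit [NumberField K] in
/-- Images of the inertia groups of conjugate primes are isomorphic (conjugation by `ρ̄(g)`).
[cite: NeukirchANT1999, Ch. I §9 (9.4)] -/
theorem isCyclic_and_card_map_inertia_smul (f : absoluteGaloisGroup K →* G) (g : absoluteGaloisGroup K)
    (𝔓 : Ideal (absIntegers (𝓞 K) K)) {n : ℕ}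
    (h : IsCyclic ((𝔓.inertia (absoluteGaloisGroup K)).map f) ∧
      Nat.card ((𝔓.inertia (absoluteGaloisGroup K)).map f) = n) :
    IsCyclic (((g • 𝔓).inertia (absoluteGaloisGroup K)).map f) ∧
      Nat.card (((g • 𝔓).inertia (absoluteGaloisGroup K)).map f) = n := by
  rw [map_inertia_smul_eq]
  exact isCyclic_and_card_of_mulEquiv
    (Subgroup.equivMapOfInjective _ _ (MulAut.conj (f g)).injective) h

end Conj

/-! ## §4 The transport to `K` at a completely split prime -/

section Split

variable {K : Type} [Field K] [NumberField K] {p : ℕ} [Fact p.Prime]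

omit [Fact p.Prime] in
/-- `primesEquiv u = p` for a place `u` of `ℚ` containing the rational prime `p`. [folklore] -/
private theorem primesEquiv_eq_of_natCast_mem {u : HeightOneSpectrum (𝓞 ℚ)}
    (hp : p.Prime) (hu : (p : 𝓞 ℚ) ∈ u.asIdeal) : (primesEquiv u : ℕ) = p := by
  have h1 : Rat.HeightOneSpectrum.natGenerator u ∣ p := by
    rw [Rat.HeightOneSpectrum.natGenerator_dvd_iff]
    have h2 := Ideal.mem_map_of_mem (Rat.IsIntegralClosure.intEquiv (𝓞 ℚ)) hu
    rwa [map_natCast] at h2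
  exact (Nat.prime_dvd_prime_iff_eq (Rat.HeightOneSpectrum.prime_natGenerator u) hp).mp h1

omit [Fact p.Prime] in
/-- A place of `K` containing `p` lies above the place `(p)` of `ℚ`. [folklore] -/
private theorem natCast_mem_under_rat {w : HeightOneSpectrum (𝓞 K)} (hpw : ((p : ℕ) : 𝓞 K) ∈ w.asIdeal) :
    (p : 𝓞 ℚ) ∈ (w.under (𝓞 ℚ)).asIdeal := by
  rw [HeightOneSpectrum.under_asIdeal, Ideal.under_def, Ideal.mem_comap, map_natCast]
  exact hpw

/-- **`res(I_{𝔓}) = I_{𝔓 ∩ \bar ℤ_ℚ}` when the decomposition group of the contraction lies in `res(Γ_K)`**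
(e.g. `p` completely split): `res⁻¹(I_𝔔) = I_𝔓` (`comap_inertia_comap_absIntegersMap`) and
`I_𝔔 ≤ D_𝔔 ≤ res(Γ_K)`. [cite: NeukirchANT1999, Ch. I §9 (9.3)–(9.6)] -/
theorem map_absGaloisRestrict_inertia_eq (𝔓 : Ideal (absIntegers (𝓞 K) K))
    (hD : (𝔓.comap (absIntegersMap ℚ K)).decompositionSubgroup (absoluteGaloisGroup ℚ) ≤
      (absGaloisRestrict ℚ K).toMonoidHom.range) :
    (𝔓.inertia (absoluteGaloisGroup K)).map (absGaloisRestrict ℚ K).toMonoidHom =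
      (𝔓.comap (absIntegersMap ℚ K)).inertia (absoluteGaloisGroup ℚ) := by
  rw [← comap_inertia_comap_absIntegersMap ℚ K 𝔓, Subgroup.map_comap_eq]
  exact inf_eq_right.mpr ((Ideal.inertia_le_decompositionSubgroup _ _).trans hD)

/-- **Serre 1972 Prop. 12 (c) over `K` at `v̄`.** Let `E/ℚ` be globally minimal with good SUPERSINGULAR
reduction at the odd prime `p` (`p ∣ a_p`), `K` an imaginary quadratic field in which `p` splits, `v ≠ v̄`
the two places above `p`. Then the inertia group `I_v̄ = GreenbergSelmer.inertia v̄ ≤ Γ_K` acts on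
`E_K[p]` through a CYCLIC group of order `p² − 1` ("l'image de `I` dans `GL(E_p)` est un groupe cyclique
d'ordre `p² − 1`", `e(K_v̄ ∣ ℚ_p) = 1`): the tree's theorem over `ℚ` at the place's prime `𝔓₀`, moved to
the conjugate prime `𝔔 = 𝔓_{v̄} ∩ \bar ℤ_ℚ = ρ 𝔓₀` (§3), identified with `res(I_v̄)` since `p` splits
completely (§4), and read on `E_K[p]` through `E(ℚ̄) ≃ E_K(K̄)` (§2).
[cite: Serre1972, §1.11 Prop. 12 c)] -/
theorem isCyclic_and_card_inertia_map_baseChange (W : WeierstrassCurve ℚ) [W.IsElliptic]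
    [W.IsGloballyMinimal] (hp2 : p ≠ 2) (hgood : W.HasGoodReductionAtPrime p)
    (hss : (p : ℤ) ∣ W.frobeniusTrace p) (hK : IsImaginaryQuadratic K)
    {v vbar : HeightOneSpectrum (𝓞 K)} (hpv : ((p : ℕ) : 𝓞 K) ∈ v.asIdeal)
    (hpvbar : ((p : ℕ) : 𝓞 K) ∈ vbar.asIdeal) (hne : vbar ≠ v) :
    IsCyclic ((GreenbergSelmer.inertia vbar).map (galoisRepTorsion (W.baseChange K) (p : ℤ))) ∧
      Nat.card ((GreenbergSelmer.inertia vbar).map (galoisRepTorsion (W.baseChange K) (p : ℤ))) =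
        p ^ 2 - 1 := by
  have hp : p.Prime := Fact.out
  haveI : Algebra.IsQuadraticExtension ℚ K := ⟨hK.1⟩
  haveI : IsGalois ℚ K := inferInstance
  -- Serre over `ℚ` at the place's prime `𝔓₀`
  set u : HeightOneSpectrum (𝓞 ℚ) := vbar.under (𝓞 ℚ) with hudef
  have hu : (primesEquiv u : ℕ) = p := primesEquiv_eq_of_natCast_mem hp (natCast_mem_under_rat hpvbar)
  obtain ⟨𝔓₀, hmem, h𝔓₀⟩ := exists_ideal_placeOver p hu
  have hT : ∀ π ζ : AlgebraicClosure ℚ, π ^ (p ^ 2 - 1) = p → ζ ^ (p ^ 2 - 1) = 1 →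
      ∃ s ∈ 𝔓₀.inertia (absoluteGaloisGroup ℚ), s • π = ζ * π := fun π ζ hπ hζ ↦
    exists_mem_inertia_smul_eq_mul_of_pow_eq p
      (Nat.sub_pos_of_lt (Nat.one_lt_pow two_ne_zero hp.one_lt)) hu h𝔓₀ hπ hζ
  have hΔ := W.not_dvd_minimalDiscriminantInt_of_hasGoodReductionAtPrime' p hgood
  have hSerre := isCyclic_and_card_inertia_map_of_dvd_frobeniusTrace p hΔ hss hp2 hmem hT
  -- the prime `𝔓_K` of `\bar ℤ_K` cut out by `v̄`, its contraction `𝔔 = ρ 𝔓₀`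
  set 𝔓K : Ideal (absIntegers (𝓞 K) K) := adicCompletionPrime K vbar with h𝔓Kdef
  have hwu : vbar.asIdeal.under (𝓞 ℚ) = u.asIdeal := (HeightOneSpectrum.under_asIdeal (𝓞 ℚ) vbar).symm
  have h𝔔 : 𝔓K.comap (absIntegersMap ℚ K) ∈ u.primesAbove :=
    comap_absIntegersMap_mem_primesAbove hwu (adicCompletionPrime_mem_primesAbove K vbar)
  obtain ⟨ρ, hρ⟩ := HeightOneSpectrum.exists_smul_eq_of_mem_primesAbove_holds h𝔓₀ h𝔔
  -- `D_𝔔 ≤ res(Γ_K)` (`p` splits completely), so `res(I_v̄) = I_𝔔`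
  have hsplit : ((u.asIdeal).primesOver (𝓞 K)).ncard = Module.finrank ℚ K :=
    ZpExtension.ncard_primesOver_under_eq_finrank_of_ne hK.1 hpvbar hpv hne.symm
  have hD : (𝔓K.comap (absIntegersMap ℚ K)).decompositionSubgroup (absoluteGaloisGroup ℚ) ≤
      (absGaloisRestrict ℚ K).toMonoidHom.range :=
    SorensenPatching.decompositionSubgroup_le_range_of_ncard_primesOver_eq hsplit h𝔔
  have hI : GreenbergSelmer.inertia vbar = 𝔓K.inertia (absoluteGaloisGroup K) :=
    (inertia_adicCompletionPrime_eq_map_absInertia K vbar).symm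
  have hres : (GreenbergSelmer.inertia vbar).map (absGaloisRestrict ℚ K).toMonoidHom =
      (ρ • 𝔓₀).inertia (absoluteGaloisGroup ℚ) := by
    rw [hI, map_absGaloisRestrict_inertia_eq 𝔓K hD, hρ]
  -- assemble
  obtain ⟨e⟩ := nonempty_mulEquiv_map_galoisRepTorsion_baseChange W K (p : ℤ)
    (GreenbergSelmer.inertia vbar)
  rw [hres] at e
  exact isCyclic_and_card_of_mulEquiv e.symm
    (isCyclic_and_card_map_inertia_smul (galoisRepTorsion W (p : ℤ)) ρ 𝔓₀ hSerre)

end Split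

end Literature.NumberTheory.EllipticCurves.InertiaFixedPoint

end
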